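import Summits.QuantumFields.YangMills.Theses.DirichletWindow
import Summits.QuantumFields.YangMills.Theorems.DirichletWindowAxialLogConvexityLimit

/-!
# `AxialLogConvexity` (routes `DirichletWindow` / `XiCompleteMonotonicity` of `YangMills`) — proved

Support item `stmt-QuantumFields-8940`: for a compact simple Lie group `G`, a lattice
representation `r`, `β ≥ 0` and EVERY infinite-volume torus-limit state
`μ ∈ infiniteVolumeLimitPoints r.ρ β` of four-dimensional Wilson lattice gauge theory, the axial
plaquette–plaquette covariance `a(n) = f_β(n e₀) = plaquetteCorrFn r.ρ μ (n e₀)` satisfies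
`0 ≤ a(n)`, `a(n+1) ≤ a(n)`, `a(n) ≤ N²` and `a(n+2)² ≤ a(n+1) a(n+3)` — the reflection-positivity
half of Chatterjee's Problem 5.1 (arXiv:1803.01950), with no condition on `G` beyond compactness
(the simplicity hypothesis of the route decl is not used).

Proof (files `DirichletWindowAxialLogConvexityTorus`, `…Limit`, this one): Osterwalder–Seiler
reflection positivity of the torus Wilson states in link and site hyperplanes (odd tori: the
mixed reflection), Cauchy–Schwarz for the centred axial plaquettes and translation invariance give
`0 ≤ A_M(n)` and `A_M(n+2)² ≤ A_M(n+1) A_M(n+3)` on all large tori; these closed inequalities and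
`A_M(n) ≤ A_M(0)` pass to the limit point along its defining subsequence of tori
(`axial_of_tendsto_tcov`); `a(0) ≤ N²` directly; and a bounded non-negative sequence that is
log-convex from index `1` on and has `a(1) ≤ a(0)` is non-increasing
(`antitone_step_of_logConvex`).

References: K. Osterwalder, E. Seiler, Ann. Phys. 110 (1978) 440, §2; E. Seiler, LNP 159 (1982)
Ch. 2; J. Fröhlich, R. Israel, E. Lieb, B. Simon, Comm. Math. Phys. 62 (1978) 1, Thm. 2.1;
S. Chatterjee, arXiv:1803.01950, Problem 5.1.
-/

noncomputable section

open MeasureTheory ProbabilityTheory Filter Topology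
open Literature.MathematicalPhysics.QuantumFieldTheory

namespace Summit.QuantumFields.YangMills.Theorems

namespace AxialLogConvexity

variable {G : Type*} [Group G] [TopologicalSpace G] [IsTopologicalGroup G] [CompactSpace G]
  [MeasurableSpace G] [BorelSpace G] {N : ℕ} (ρ : G →* Matrix (Fin N) (Fin N) ℂ)

/-! ### Elementary: bounded log-convex non-negative sequences are non-increasing -/

/-- A non-negative bounded sequence which is log-convex from index `1` on
(`a(n+1)² ≤ a(n) a(n+2)` for `n ≥ 1`) is non-increasing from index `1` on. [folklore] -/
theorem antitone_step_of_logConvex {a : ℕ → ℝ} {B : ℝ} (h0 : ∀ n, 0 ≤ a n) (hB : ∀ n, a n ≤ B)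
    (hlc : ∀ n, 1 ≤ n → a (n + 1) ^ 2 ≤ a n * a (n + 2)) {n : ℕ} (hn : 1 ≤ n) :
    a (n + 1) ≤ a n := by
  refine le_of_not_gt fun hlt => ?_
  have han : 0 < a n := by
    rcases (h0 n).eq_or_lt with h | h
    · have h1 := hlc n hn
      rw [← h, zero_mul] at h1
      have h2 : a (n + 1) = 0 := le_antisymm (by nlinarith [h0 (n + 1)]) (h0 (n + 1))
      linarith [h0 (n + 1)]
    · exact h
  set r : ℝ := a (n + 1) / a n with hr
  have hr1 : 1 < r := (one_lt_div han).2 hlt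
  -- geometric growth from log-convexity
  have key : ∀ k : ℕ, r * a (n + k) ≤ a (n + k + 1) ∧ 0 < a (n + k) := by
    intro k
    induction k with
    | zero =>
      refine ⟨le_of_eq ?_, han⟩
      rw [add_zero, hr, div_mul_cancel₀ _ han.ne']
    | succ k ih =>
      obtain ⟨ih1, ih2⟩ := ih
      have hpos : 0 < a (n + k + 1) := lt_of_lt_of_le (mul_pos (by linarith) ih2) ih1
      refine ⟨?_, by rw [← add_assoc]; exact hpos⟩
      have hlc' := hlc (n + k) (by omega)
      have hm : a (n + k + 1) * (r * a (n + k)) ≤ a (n + k + 1) * a (n + k + 1) :=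
        mul_le_mul_of_nonneg_left ih1 (h0 _)
      have h3 : r * a (n + k + 1) * a (n + k) ≤ a (n + k + 2) * a (n + k) := by nlinarith [hm, hlc']
      rw [show n + (k + 1) = n + k + 1 by omega, show n + k + 1 + 1 = n + k + 2 by omega]
      exact le_of_mul_le_mul_right h3 ih2
  have growth : ∀ k : ℕ, r ^ k * a n ≤ a (n + k) := by
    intro k
    induction k with
    | zero => simp
    | succ k ih =>
      calc r ^ (k + 1) * a n = r * (r ^ k * a n) := by ring
        _ ≤ r * a (n + k) := mul_le_mul_of_nonneg_left ih (by linarith)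
        _ ≤ a (n + k + 1) := (key k).1
        _ = a (n + (k + 1)) := by rw [add_assoc]
  obtain ⟨k, hk⟩ := pow_unbounded_of_one_lt (B / a n) hr1
  have : B < a (n + k) := by
    calc B = B / a n * a n := by rw [div_mul_cancel₀ _ han.ne']
      _ < r ^ k * a n := mul_lt_mul_of_pos_right hk han
      _ ≤ a (n + k) := growth k
  linarith [hB (n + k)]

/-! ### The theorem -/

section Main

open Literature.MathematicalPhysics.QuantumLattice

/-- **Assembly over an abstract axial sequence**: if the torus axial covariances
`T k = A_{L_k+1}` (given through their characterising identity `hTdef`) satisfy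
`T k (m) → a(m)` along tori `L_k + 1 → ∞` (`β ≥ 0`) and `a(0) ≤ B`, then `0 ≤ a(n)`,
`a(n+1) ≤ a(n)`, `a(n) ≤ B` and `a(n+2)² ≤ a(n+1) a(n+3)`. [folklore] -/
theorem axial_of_tendsto_tcov (hρ : Continuous ρ) {β : ℝ} (hβ : 0 ≤ β) {Ls : ℕ → ℕ}
    (hLs : StrictMono Ls) {T : (k : ℕ) → ZMod (Ls k + 1) → ℝ}
    (hTdef : ∀ (k : ℕ) (c : ZMod (Ls k + 1)), T k c =
      cov[fun U => WilsonRP.plaqRe ρ U ((Pi.single 0 0 : Site 4 (Ls k + 1)), ⟨(0, 1), Fin.zero_lt_one⟩),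
        fun U => WilsonRP.plaqRe ρ U ((Pi.single 0 c : Site 4 (Ls k + 1)), ⟨(0, 1), Fin.zero_lt_one⟩);
        wilsonMeasure (d := 4) (L := Ls k + 1) ρ β])
    {a : ℕ → ℝ} {B : ℝ} (hT : ∀ m : ℕ, Tendsto (fun k : ℕ => T k ((m : ℕ) : ZMod (Ls k + 1))) atTop (𝓝 (a m)))
    (h0B : a 0 ≤ B) (n : ℕ) :
    0 ≤ a n ∧ a (n + 1) ≤ a n ∧ a n ≤ B ∧ a (n + 2) ^ 2 ≤ a (n + 1) * a (n + 3) := by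
  have hq : (⟨(0, 1), Fin.zero_lt_one⟩ : {p : Fin 4 × Fin 4 // p.1 < p.2}).1.1 = 0 := rfl
  have hev : ∀ c : ℕ, ∀ᶠ k : ℕ in atTop, c ≤ Ls k + 1 := fun c =>
    (hLs.tendsto_atTop.eventually (eventually_ge_atTop c)).mono fun k hk => by omega
  -- (1) non-negativity
  have hnonneg : ∀ m, 0 ≤ a m := by
    intro m
    rcases Nat.eq_zero_or_pos m with rfl | hm
    · exact ge_of_tendsto (hT 0) (Eventually.of_forall fun k => by
        show 0 ≤ T k ((0 : ℕ) : ZMod (Ls k + 1))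
        rw [Nat.cast_zero]
        exact tcov_zero_nonneg ρ (hTdef k) hρ)
    · exact ge_of_tendsto (hT m) ((hev (m + 3)).mono fun k hk =>
        tcov_natCast_nonneg ρ (hTdef k) hq hρ hβ hm hk)
  -- (2) log-convexity
  have hlc : ∀ m, a (m + 2) ^ 2 ≤ a (m + 1) * a (m + 3) := fun m =>
    le_of_tendsto_of_tendsto ((hT (m + 2)).pow 2) ((hT (m + 1)).mul (hT (m + 3)))
      ((hev (m + 6)).mono fun k hk => tcov_natCast_logConvex ρ (hTdef k) hq hρ hβ hk)
  -- (3) domination by the variance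
  have hle0 : ∀ m, a m ≤ a 0 := fun m =>
    le_of_tendsto_of_tendsto (hT m) (hT 0) (Eventually.of_forall fun k => by
      show T k ((m : ℕ) : ZMod (Ls k + 1)) ≤ T k ((0 : ℕ) : ZMod (Ls k + 1))
      rw [Nat.cast_zero]
      exact tcov_le_tcov_zero ρ (hTdef k) hρ _)
  -- (4) monotonicity
  have hmono : ∀ m, a (m + 1) ≤ a m := by
    intro m
    rcases Nat.eq_zero_or_pos m with rfl | hm
    · exact hle0 1
    · exact antitone_step_of_logConvex hnonneg (fun k => (hle0 k).trans h0B)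
        (fun k hk => by
          have := hlc (k - 1)
          rwa [show k - 1 + 2 = k + 1 by omega, show k - 1 + 1 = k by omega,
            show k - 1 + 3 = k + 2 by omega] at this) hm
  exact ⟨hnonneg n, hmono n, (hle0 n).trans h0B, hlc n⟩

/-- **Axial log-convexity, non-negativity, boundedness and monotonicity of the plaquette
two-point function of an infinite-volume torus-limit state** (`β ≥ 0`, continuous `ρ`, any
compact `G`): with `a(n) = plaquetteCorrFn ρ μ (n e₀)`, `0 ≤ a(n)`, `a(n+1) ≤ a(n)`, `a(n) ≤ N²`
and `a(n+2)² ≤ a(n+1) a(n+3)`. [folklore] -/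
theorem plaquetteCorrFn_axial (hρ : Continuous ρ) {β : ℝ} (hβ : 0 ≤ β) {μ : Measure (LGConfig 4 G)}
    (hμ : μ ∈ infiniteVolumeLimitPoints (d := 4) ρ β) (n : ℕ) :
    0 ≤ plaquetteCorrFn ρ μ ((n : ℤ) • Pi.single (0 : Fin 4) (1 : ℤ)) ∧
      plaquetteCorrFn ρ μ (((n + 1 : ℕ) : ℤ) • Pi.single (0 : Fin 4) (1 : ℤ)) ≤
        plaquetteCorrFn ρ μ ((n : ℤ) • Pi.single (0 : Fin 4) (1 : ℤ)) ∧
      plaquetteCorrFn ρ μ ((n : ℤ) • Pi.single (0 : Fin 4) (1 : ℤ)) ≤ (N : ℝ) ^ 2 ∧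
      plaquetteCorrFn ρ μ (((n + 2 : ℕ) : ℤ) • Pi.single (0 : Fin 4) (1 : ℤ)) ^ 2 ≤
        plaquetteCorrFn ρ μ (((n + 1 : ℕ) : ℤ) • Pi.single (0 : Fin 4) (1 : ℤ)) *
          plaquetteCorrFn ρ μ (((n + 3 : ℕ) : ℤ) • Pi.single (0 : Fin 4) (1 : ℤ)) := by
  obtain ⟨Ls, hLs, hlim⟩ := hμ
  haveI : IsProbabilityMeasure μ := hlim.1
  have h0 : plaquetteCorrFn ρ μ (((0 : ℕ) : ℤ) • Pi.single (0 : Fin 4) (1 : ℤ)) ≤ (N : ℝ) ^ 2 := by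
    rw [Nat.cast_zero, zero_smul]
    exact plaquetteCorrFn_zero_le ρ hρ μ
  have hT : ∀ m : ℕ, Tendsto (fun k : ℕ => (fun (k : ℕ) (c : ZMod (Ls k + 1)) =>
      cov[fun U => WilsonRP.plaqRe ρ U ((Pi.single 0 0 : Site 4 (Ls k + 1)), ⟨(0, 1), Fin.zero_lt_one⟩),
        fun U => WilsonRP.plaqRe ρ U ((Pi.single 0 c : Site 4 (Ls k + 1)), ⟨(0, 1), Fin.zero_lt_one⟩);
        wilsonMeasure (d := 4) (L := Ls k + 1) ρ β]) k ((m : ℕ) : ZMod (Ls k + 1))) atTop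
      (𝓝 ((fun m : ℕ => plaquetteCorrFn ρ μ ((m : ℤ) • Pi.single (0 : Fin 4) (1 : ℤ))) m)) :=
    fun m => tendsto_tcov ρ hρ hlim m
  have key := axial_of_tendsto_tcov ρ hρ hβ hLs (fun k c => rfl) hT h0 n
  exact key

end Main

end AxialLogConvexity

/-- **`AxialLogConvexity` holds** (support item `stmt-QuantumFields-8940` of routes
`DirichletWindow` and `XiCompleteMonotonicity`): the route decl
`Summit.QuantumFields.YangMills.Theses.DirichletWindow.AxialLogConvexity`, from
`AxialLogConvexity.plaquetteCorrFn_axial` (reflection positivity of the torus Wilson states in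
link and site hyperplanes, odd tori included, and passage to the limit point); the simplicity of
`G` is not used. [folklore] -/
theorem AxialLogConvexity_proof :
    Summit.QuantumFields.YangMills.Theses.DirichletWindow.AxialLogConvexity := by
  intro G _ _ _ _ _ _ _ r β hβ μ hμ n
  exact AxialLogConvexity.plaquetteCorrFn_axial r.ρ r.continuous hβ hμ n

end Summit.QuantumFields.YangMills.Theorems

end
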